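import Mathlib
import HarnessLib
import Summits.Ventures.LatticeQCDFlow.Exactness.SphereLuscherConstantsParityTorus
import Summits.Ventures.LatticeQCDFlow.Exactness.SphereActionThirdMoment

/-!
# The periodic hypercubic lattice `(ℤ/L)^ν` with `L ≠ 3` has no triangles: for the CP(N−1)/O(N) action with nearest-neighbour transporters the third cumulant and Lüscher's NNLO constant `ċ₂` vanish for EVERY side length `L ≠ 3`, even or odd

HONEST FRAMING: exact (Metropolis-corrected) sampling algorithms for lattice gauge theory;
figures of merit are autocorrelation/cost numbers at stated couplings and volumes; no
continuum-physics claim.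

Venture `LatticeQCDFlow` (cell pub-lqcd), topic `Exactness`; FANOUT row 7 (`s0-cpn-null`: the
S0-D1 rung — 2D CP⁹ on periodic `L × L` lattices).  NEW WORK of the cell over the tree's
`Exactness/SphereActionThirdMoment.lean` (this leg: `∫(S − S₀)³ dπ̄ = −(8κ³/d³)·Σ τ` and
`ċ₂ = (4κ³/d³)·Σ τ`, zero on triangle-free coupling graphs) and
`Exactness/SphereLuscherConstantsParityTorus.lean` (this leg: the torus `Site ν L = (ℤ/L)^ν`,
nearest-neighbour coupling families, `ċ_{2j} = 0` for EVEN `L`); the torus is the tree's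
`Literature/…/ConstructiveQFTWave0` (`Site`, `Site.shift`).  Nothing is cited as a fact.  Printed
counterpart, NAMED ONLY: Engel–Schaefer, Comput. Phys. Commun. 182 (2011) 2107, §2; M. Lüscher,
Commun. Math. Phys. 293 (2010) 899, §4.2.

## Content

* §1 **`torus_nn_step_eq`** — a nearest-neighbour step on the torus is `y = x + single i s` with
  `s = ±1`; **`torus_nn_triangle_free`** — for `L ≠ 3` (any `ν`, `L ≥ 1`) a nearest-neighbour
  coupling family with no self-coupling is TRIANGLE-FREE: `U_kn ≠ 0 ∧ U_nm ≠ 0 ⇒ U_km = 0`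
  (three unit steps `±e_i ± e_j = ±e_l` close up only if `3 = 0` or `1 = 0` in `ℤ/L`, i.e. `L ∣ 3`;
  `L = 1` is a single site, where `U_kk = 0` decides).  For `L = 3` the torus does contain the
  triangles `x, x + e_i, x + 2e_i`.
* §2 **`third_moment_esAction_eq_zero_torus`** and **`luscher_constant_two_eq_zero_torus_of_ne_three`**
  — hence on `(ℤ/L)^ν`, `L ≠ 3`, the E–S action has `∫(S − S₀)³ dπ̄ = 0` and every `C²` Lüscher series
  has `ċ₂ = 0`: the NNLO constant vanishes on the rung's lattices for every `L ≥ 4`, ODD sides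
  included (where the parity argument of `SphereLuscherConstantsParityTorus` is unavailable and
  `ċ₄` need not vanish).

NOT CLAIMED: `ċ₄ = 0` for odd `L` (false in general: pentagons-free is not the issue, odd closed
walks of length 5 wrap around the torus when `L = 5`); anything for `L = 3`; the rung's numbers.
-/

noncomputable section

namespace Summit.Ventures.LatticeQCDFlow.Exactness

open Function Set Metric MeasureTheory NormedSpace InnerProductSpace
  Literature.MathematicalPhysics.QuantumFieldTheory
open scoped RealInnerProductSpace

/-! ## §1 The nearest-neighbour torus graph with `L ≠ 3` is triangle-free -/

section Torus

variable {ν L : ℕ}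

/-- A nearest-neighbour pair differs by a signed unit vector: `y = x + single i s`, `s = ±1`. -/
theorem torus_nn_step_eq {x y : Site ν L} (h : ∃ i : Fin ν, y = x.shift i ∨ x = y.shift i) :
    ∃ (i : Fin ν) (s : ZMod L), (s = 1 ∨ s = -1) ∧ y = x + Pi.single i s := by
  obtain ⟨i, h | h⟩ := h
  · exact ⟨i, 1, Or.inl rfl, h⟩
  · refine ⟨i, -1, Or.inr rfl, ?_⟩
    rw [h, Site.shift, add_assoc, ← Pi.single_add, add_neg_cancel, Pi.single_zero, add_zero]

/-- Three signed unit steps that close up force `L ∣ 3`: if `single i s₁ + single j s₂ = single l s₃`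
in `(ℤ/L)^ν` with all `s = ±1`, then `(3 : ℤ/L) = 0`. -/
theorem torus_three_eq_zero_of_steps {i j l : Fin ν} {s₁ s₂ s₃ : ZMod L}
    (h₁ : s₁ = 1 ∨ s₁ = -1) (h₂ : s₂ = 1 ∨ s₂ = -1) (h₃ : s₃ = 1 ∨ s₃ = -1)
    (h : (Pi.single i s₁ : Site ν L) + Pi.single j s₂ = Pi.single l s₃) : (3 : ZMod L) = 0 := by
  -- a signed unit `s` with `s = 0` forces `1 = 0`, whence `3 = 0`
  have hunit : ∀ {s : ZMod L}, (s = 1 ∨ s = -1) → s = 0 → (3 : ZMod L) = 0 := by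
    rintro s (rfl | rfl) hs
    · linear_combination (3 : ZMod L) * hs
    · linear_combination (-3 : ZMod L) * hs
  have hl := congr_fun h l
  have hi := congr_fun h i
  have hj := congr_fun h j
  simp only [Pi.add_apply, Pi.single_apply] at hl hi hj
  by_cases hil : i = l
  · subst hil
    by_cases hji : j = i
    · subst hji
      simp only [if_true] at hi
      -- `s₁ + s₂ = s₃` with all three signed units: `2 = ±1`, `0 = ±1` or `−2 = ±1`
      rcases h₁ with rfl | rfl <;> rcases h₂ with rfl | rfl <;> rcases h₃ with rfl | rfl <;>
        first
        | linear_combination (3 : ZMod L) * hi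
        | linear_combination hi
        | linear_combination (-3 : ZMod L) * hi
        | linear_combination (-1 : ZMod L) * hi
    · -- `j ≠ i = l`: the `j`-coordinate reads `s₂ = 0`
      simp only [hji, if_true, if_false, zero_add] at hj
      exact hunit h₂ hj
  · by_cases hjl : j = l
    · subst hjl
      -- `i ≠ j = l`: the `i`-coordinate reads `s₁ = 0`
      simp only [if_true, hil, if_false, add_zero] at hi
      exact hunit h₁ hi
    · -- `i ≠ l`, `j ≠ l`: the `l`-coordinate reads `0 = s₃`
      have hli : ¬l = i := Ne.symm hil
      have hlj : ¬l = j := Ne.symm hjl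
      simp only [hli, hlj, if_true, if_false, zero_add] at hl
      exact hunit h₃ hl.symm

/-- **THE NEAREST-NEIGHBOUR TORUS GRAPH WITH `L ≠ 3` IS TRIANGLE-FREE.**  For a coupling family on
`(ℤ/L)^ν` with no self-coupling and `U x y ≠ 0` only between nearest neighbours, and `L ≠ 3`:
`U_kn ≠ 0 ∧ U_nm ≠ 0 ⇒ U_km = 0` (if `k = m` this is `U_kk = 0`; otherwise three signed unit steps
would close up, forcing `L ∣ 3`, and `L = 1` is a single site). -/
theorem torus_nn_triangle_free [NeZero L] (hL3 : L ≠ 3) {β : Type*} [Zero β]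
    (U : Site ν L → Site ν L → β) (hU0 : ∀ x, U x x = 0)
    (hNN : ∀ x y, U x y ≠ 0 → ∃ i : Fin ν, y = x.shift i ∨ x = y.shift i) :
    ∀ k n m, U k n ≠ 0 → U n m ≠ 0 → U k m = 0 := by
  intro k n m hkn hnm
  by_cases hkm : k = m
  · subst hkm; exact hU0 k
  by_contra hU
  obtain ⟨i, s₁, hs₁, hn⟩ := torus_nn_step_eq (hNN k n hkn)
  obtain ⟨j, s₂, hs₂, hm⟩ := torus_nn_step_eq (hNN n m hnm)
  obtain ⟨l, s₃, hs₃, hm'⟩ := torus_nn_step_eq (hNN k m hU)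
  have hsteps : (Pi.single i s₁ : Site ν L) + Pi.single j s₂ = Pi.single l s₃ := by
    have h : k + (Pi.single i s₁ + Pi.single j s₂) = k + Pi.single l s₃ := by
      rw [← add_assoc, ← hn, ← hm, ← hm']
    exact add_left_cancel h
  have h3 : ((3 : ℕ) : ZMod L) = 0 := by
    exact_mod_cast torus_three_eq_zero_of_steps hs₁ hs₂ hs₃ hsteps
  have hdvd : L ∣ 3 := (ZMod.natCast_eq_zero_iff 3 L).mp h3
  have hL1 : L = 1 := ((Nat.dvd_prime Nat.prime_three).mp hdvd).resolve_right hL3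
  subst hL1
  exact hkm (Subsingleton.elim k m)

end Torus

/-! ## §2 The E–S action on `(ℤ/L)^ν`, `L ≠ 3`: vanishing third cumulant and `ċ₂ = 0` -/

section Action

variable {ν L : ℕ} [NeZero L] {E : Type*} [NormedAddCommGroup E] [InnerProductSpace ℝ E]
  [FiniteDimensional ℝ E] [MeasurableSpace E] [BorelSpace E] [Nontrivial E]
  {U : Site ν L → Site ν L → (E →L[ℝ] E)}

/-- **The third central moment of the CP(N−1)/O(N) action vanishes on the torus `(ℤ/L)^ν`, `L ≠ 3`**
(nearest-neighbour transporters, no self-coupling, adjoint pairs, `d ≥ 2`): the coupling graph is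
triangle-free. -/
theorem third_moment_esAction_eq_zero_torus (hL3 : L ≠ 3) (h2 : 2 ≤ Module.finrank ℝ E)
    (hU0 : ∀ n, U n n = 0) (hUadj : ∀ m n (v w : E), ⟪U m n v, w⟫ = ⟪v, U n m w⟫)
    (hNN : ∀ x y, U x y ≠ 0 → ∃ i : Fin ν, y = x.shift i ∨ x = y.shift i) (κ S₀ : ℝ) :
    ∫ ω, (esAction κ S₀ U (fun m => ((ω : Site ν L → sphere (0 : E) 1) m : E)) - S₀) ^ 3
        ∂Measure.pi (fun _ : Site ν L => uniformSphere (volume : Measure E)) = 0 :=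
  third_moment_esAction_eq_zero_of_triangle_free h2 hU0 hUadj
    (torus_nn_triangle_free hL3 U hU0 hNN) κ S₀

variable {St : ℕ → (Site ν L → E) → ℝ} {c : ℕ → ℝ}

/-- **`ċ₂ = 0` ON THE TORUS `(ℤ/L)^ν` FOR EVERY `L ≠ 3`, EVEN OR ODD**: for nearest-neighbour
transporters (no self-coupling, adjoint pairs, `d ≥ 2`) every `C²` Lüscher series of the E–S action
has vanishing NNLO constant — for odd `L ≥ 5` the parity argument is unavailable, but the
triangle sum still vanishes. -/
theorem luscher_constant_two_eq_zero_torus_of_ne_three (hL3 : L ≠ 3) (h2 : 2 ≤ Module.finrank ℝ E)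
    (hU0 : ∀ n, U n n = 0) (hUadj : ∀ m n (v w : E), ⟪U m n v, w⟫ = ⟪v, U n m w⟫)
    (hNN : ∀ x y, U x y ≠ 0 → ∃ i : Fin ν, y = x.shift i ∨ x = y.shift i) (κ S₀ : ℝ)
    (hSt : ∀ k, ContDiff ℝ 2 (St k))
    (h0 : ∀ ξ : Site ν L → sphere (0 : E) 1,
      -∑ n, siteLaplacian n (St 0) (fun m => (ξ m : E)) = esAction κ S₀ U (fun m => (ξ m : E)) + c 0)
    (hs : ∀ k, ∀ ξ : Site ν L → sphere (0 : E) 1,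
      -∑ n, siteLaplacian n (St (k + 1)) (fun m => (ξ m : E)) =
        -(∑ n, ⟪siteGrad n (esAction κ S₀ U) (fun m => (ξ m : E)),
            siteGrad n (St k) (fun m => (ξ m : E))⟫) + c (k + 1)) :
    c 2 = 0 :=
  luscher_constant_two_eq_zero_of_triangle_free h2 hU0 hUadj (torus_nn_triangle_free hL3 U hU0 hNN)
    κ S₀ hSt h0 hs

end Action

end Summit.Ventures.LatticeQCDFlow.Exactness

end
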